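import Summits.KontsevichZagierPeriods.KontsevichZagierPeriods.Theorems.LinRedNormalFormArrangementNormalFormStubUnletterPatterns

/-!
# `ArrangementNormalForm` (stmt-KontsevichZagierPeriods-3915), line `janus-bands`, stub `stub_unletter` — (5/5) dissection of a bounded lettered order cell

Support file for `stub_unletter` (Janus band representations of base dimension `0` are congruent,
modulo `KZ.relations`, to `ℤ`-combinations of LETTERED ORDER CELLS); normal form, class integrand
`cint` and admissibility `Adm` as in the definitions file.  Helpers live in `…JanusBands.Unletter`.

This file: normalising a piece onto the simplex by one affine change of variables
(`restrict_piece_mem_RS`); the cell is DECIDED on a piece (`mem_cell_of_mem_piece`); the exceptional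
set is null (`volume_excSet`); generic points lie in pieces (`exists_mem_piece`); the dissection
theorem `orderCell_mem_RS` (rule 1a over all patterns, `KZ.of_sub_sum_of_mem_relations`).

References: M. Kontsevich, D. Zagier, *Periods* (2001), §1.2.
-/

noncomputable section

open Set MeasureTheory MvPolynomial
open Literature.NumberTheory.Transcendental
open Literature.ModelTheory.ExponentialFields (IsSemialgebraic)

namespace Summit.KontsevichZagierPeriods.ArrangementNormalForm.JanusBands

/-- Registered support goal of this file: strictly between the extreme values of a strictly
increasing finite sequence and off its values, every real lies in a gap of the sequence. -/
theorem unletter_exists_gap (M : ℕ) (κ : Fin (M + 1) ↪o ℚ) (y : ℝ) (h0 : (κ 0 : ℝ) < y) (h1 : y < κ (Fin.last M)) (hne : ∀ j, y ≠ κ j) : ∃ j : Fin M, (κ (Fin.castSucc j) : ℝ) < y ∧ y < κ (Fin.succ j) := by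
  classical
  set S : Finset (Fin (M + 1)) := Finset.univ.filter fun j => (κ j : ℝ) < y with hS
  have hSne : S.Nonempty := ⟨0, by simp [hS, h0]⟩
  set jm := S.max' hSne with hjm
  have hjmS : jm ∈ S := S.max'_mem hSne
  have hjm_lt : (κ jm : ℝ) < y := by simpa [hS] using hjmS
  have hjm_ne : jm ≠ Fin.last M := by
    rintro h; rw [h] at hjm_lt; linarith
  set j := jm.castPred hjm_ne with hj
  have hj' : Fin.castSucc j = jm := Fin.castSucc_castPred _ _
  refine ⟨j, by rw [hj']; exact hjm_lt, lt_of_le_of_ne ?_ (hne _)⟩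
  by_contra hlt
  push Not at hlt
  have hmem : Fin.succ j ∈ S := by simp [hS, hlt]
  have := S.le_max' _ hmem
  rw [← hjm, ← hj', Fin.le_def] at this
  simp at this

namespace Unletter

section Patterns

variable {k M : ℕ} (κ : Fin (M + 1) ↪o ℚ)

/-- **Normalising a piece** (rule 2 along the affine map `nmap`, then the classification of the
normalised representation): if the piece `S(r, σ)` lies in the domain of `s` and the integrand of
`s` is a pure product `q ∏ lett (a i) (zᵢ)`, the restriction of `s` to the piece lies in `RS`. -/
theorem restrict_piece_mem_RS (r : Fin k → Fin M) (σ : Equiv.Perm (Fin k)) (s : KZ.IntegralRep k)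
    (q : ℚ) (a : Fin k → Option ℚ) (hsub : piece κ r σ ⊆ s.domain)
    (hint : EqOn s.integrand (fun z => (q : ℝ) * ∏ i, lett (a i) (z i)) s.domain) :
    KZ.of (s.restrict (piece κ r σ) (isSemialgebraic_piece κ r σ) hsub) ∈ RS := by
  classical
  set J : ℝ := ∏ i, (gd κ r i : ℝ) with hJ
  have hJdet : J * |(nlin κ r σ).det| = 1 := by
    rw [abs_det_nlin, hJ, ← Finset.prod_mul_distrib]
    exact Finset.prod_eq_one fun i _ => mul_inv_cancel₀ (by exact_mod_cast (gd_pos κ r i).ne')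
  have hΔ := KZ.isSemialgebraic_openOrderedSimplex k
  -- the normalised representation
  have hmapInv : IsSemialgebraicMapOn ℚ (KZ.openOrderedSimplex k) (nmapInv κ r σ) :=
    (isSemialgebraicMapOn_aeval hΔ fun i =>
      (C (glo κ r i) + C (gd κ r i) * X (σ.symm i) : MvPolynomial (Fin k) ℚ)).congr
      fun y _ => (nmapInv_eq_aeval κ r σ y).symm
  have hmaps : MapsTo (nmapInv κ r σ) (KZ.openOrderedSimplex k) s.domain := fun y hy =>
    hsub (nmapInv_mem_piece κ r σ hy)
  have hfun : IsSemialgebraicFunOn ℚ (KZ.openOrderedSimplex k)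
      fun y => s.integrand (nmapInv κ r σ y) * J := by
    have h1 := IsSemialgebraicFunOn.comp_isSemialgebraicMapOn_holds
      s.isSemialgebraicFunOn_integrand hmapInv hmaps
    have h2 : IsSemialgebraicFunOn ℚ (KZ.openOrderedSimplex k) fun _ => J :=
      (isSemialgebraicFunOn_aeval hΔ (C (∏ i, gd κ r i) : MvPolynomial (Fin k) ℚ)).congr
        fun y _ => by simp [hJ]
    exact (IsSemialgebraicFunOn.mul_holds h1 h2).congr fun y _ => rfl
  have hpiece_m : MeasurableSet (piece κ r σ) :=
    Literature.ModelTheory.ExponentialFields.IsSemialgebraic.measurableSet_holds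
      (isSemialgebraic_piece κ r σ)
  have hderiv : ∀ z ∈ piece κ r σ, HasFDerivWithinAt (nmap κ r σ) (nlin κ r σ) (piece κ r σ) z := by
    intro z _
    have : nmap κ r σ = fun z => nlin κ r σ z + fun j => -(glo κ r (σ j) : ℝ) / gd κ r (σ j) :=
      funext (nmap_eq_nlin_add κ r σ)
    rw [this]
    exact ((nlin κ r σ).hasFDerivAt.add_const _).hasFDerivWithinAt
  have hinj : InjOn (nmap κ r σ) (piece κ r σ) := fun z _ z' _ h => by
    have := congr_arg (nmapInv κ r σ) h
    rwa [nmapInv_nmap, nmapInv_nmap] at this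
  have hintg : IntegrableOn (fun y => s.integrand (nmapInv κ r σ y) * J) (KZ.openOrderedSimplex k) := by
    rw [← nmap_image_piece κ r σ,
      integrableOn_image_iff_integrableOn_abs_det_fderiv_smul volume hpiece_m hderiv hinj]
    refine (s.integrableOn.mono_set hsub).congr_fun (fun z _ => ?_) hpiece_m
    simp only [smul_eq_mul, nmapInv_nmap]
    calc s.integrand z = s.integrand z * (J * |(nlin κ r σ).det|) := by rw [hJdet, mul_one]
      _ = _ := by ring
  let R₂ : KZ.IntegralRep k := ⟨KZ.openOrderedSimplex k, fun y => s.integrand (nmapInv κ r σ y) * J,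
    hΔ, hfun, hintg⟩
  -- rule 2
  have hcov : KZ.of (s.restrict (piece κ r σ) (isSemialgebraic_piece κ r σ) hsub) - KZ.of R₂ ∈
      KZ.relations := by
    refine KZ.changeOfVariablesRel_subset_relations ⟨k, _, R₂, nmap κ r σ, fun _ => nlin κ r σ,
      ?_, hderiv, hinj, (nmap_image_piece κ r σ).symm, fun z _ => ?_, rfl⟩
    · exact (isSemialgebraicMapOn_aeval (isSemialgebraic_piece κ r σ) fun j =>
        (C (1 / gd κ r (σ j)) * (X (σ j) - C (glo κ r (σ j))) : MvPolynomial (Fin k) ℚ)).congr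
        fun z _ => (nmap_eq_aeval κ r σ z).symm
    · change s.integrand z = s.integrand (nmapInv κ r σ (nmap κ r σ z)) * J * |(nlin κ r σ).det|
      rw [nmapInv_nmap, mul_assoc, hJdet, mul_one]
  -- the normalised integrand is a pure product with rescaled letters
  set a'' : Fin k → Option ℚ := fun j => (a (σ j)).map fun c => (c - glo κ r (σ j)) / gd κ r (σ j)
    with ha''
  set q' : ℚ := q * ∏ i, (a i).elim (gd κ r i) (fun _ => 1) with hq'
  have hEq : EqOn R₂.integrand (cint (C q') a'') (KZ.openOrderedSimplex k) := by
    intro y hy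
    change s.integrand (nmapInv κ r σ y) * J = _
    rw [hint (hmaps hy), cint, hq', hJ, mul_assoc, ← Finset.prod_mul_distrib,
      ← Equiv.prod_comp σ (fun i => lett (a i) (nmapInv κ r σ y i) * (gd κ r i : ℝ)),
      ← Equiv.prod_comp σ (fun i => (a i).elim (gd κ r i) (fun _ => (1 : ℚ)))]
    simp only [map_mul, aeval_C, eq_ratCast, Rat.cast_prod, mul_assoc, ← Finset.prod_mul_distrib]
    congr 1
    refine Finset.prod_congr rfl fun j _ => ?_
    have hd : (gd κ r (σ j) : ℝ) ≠ 0 := by exact_mod_cast (gd_pos κ r (σ j)).ne'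
    simp only [nmapInv, Equiv.symm_apply_apply, ha'']
    cases a (σ j) with
    | none => simp
    | some c =>
      simp only [lett_some, Option.map_some, Option.elim_some, Rat.cast_one, one_mul, Rat.cast_div,
        Rat.cast_sub]
      have : (y j : ℝ) - (((c : ℝ) - glo κ r (σ j)) / gd κ r (σ j)) =
          ((glo κ r (σ j) : ℝ) + gd κ r (σ j) * y j - c) / gd κ r (σ j) := by
        field_simp
        ring
      rw [this, one_div_div, one_div_mul_eq_div]
  -- the normalised representation is admissible (necessity) or vanishes
  refine mem_RS_of_sub_mem hcov ?_
  by_cases hq0 : q' = 0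
  · refine mem_RS_of_mem_relations (KZ.of_mem_relations_of_eqOn_zero R₂ fun y hy => ?_)
    rw [hEq hy, hq0, cint]
    simp
  · exact OC_subset_RS k ⟨R₂, C q', a'', adm_of_integrableOn hq0
      (hintg.congr_fun hEq (KZ.measurableSet_openOrderedSimplex k)), rfl, hEq, rfl⟩

/-- On a piece, a constant lower bound among the `κ j` is decided by the gap. -/
theorem const_lt_iff_of_mem_piece {r : Fin k → Fin M} {σ : Equiv.Perm (Fin k)} {z : Fin k → ℝ}
    (hz : z ∈ piece κ r σ) (i : Fin k) {c : ℚ} (hc : c ∈ Set.range κ) :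
    (c : ℝ) < z i ↔ c ≤ glo κ r i := by
  obtain ⟨j, rfl⟩ := hc
  have hg := mem_gap_of_mem_piece κ hz i
  constructor
  · intro h
    by_contra hlt
    push Not at hlt
    have hj : Fin.succ (r i) ≤ j := by
      have : Fin.castSucc (r i) < j := κ.lt_iff_lt.1 hlt
      rw [Fin.lt_def] at this; rw [Fin.le_def]; simp only [Fin.val_succ, Fin.val_castSucc] at this ⊢; omega
    have : (κ (Fin.succ (r i)) : ℝ) ≤ κ j := by exact_mod_cast κ.monotone hj
    simp only [glo, gd, Rat.cast_sub] at hg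
    linarith
  · intro h
    have : (κ j : ℝ) ≤ glo κ r i := by exact_mod_cast h
    linarith [hg.1]

/-- On a piece, a constant upper bound taken among the `κ j` is decided by the gap. -/
theorem lt_const_iff_of_mem_piece {r : Fin k → Fin M} {σ : Equiv.Perm (Fin k)} {z : Fin k → ℝ}
    (hz : z ∈ piece κ r σ) (i : Fin k) {c : ℚ} (hc : c ∈ Set.range κ) :
    z i < (c : ℝ) ↔ κ (Fin.succ (r i)) ≤ c := by
  obtain ⟨j, rfl⟩ := hc
  have hg := mem_gap_of_mem_piece κ hz i
  simp only [glo, gd, Rat.cast_sub] at hg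
  constructor
  · intro h
    by_contra hlt
    push Not at hlt
    have hj : j ≤ Fin.castSucc (r i) := by
      have : j < Fin.succ (r i) := κ.lt_iff_lt.1 hlt
      rw [Fin.lt_def] at this; rw [Fin.le_def]; simp only [Fin.val_succ, Fin.val_castSucc] at this ⊢; omega
    have : (κ j : ℝ) ≤ κ (Fin.castSucc (r i)) := by exact_mod_cast κ.monotone hj
    linarith
  · intro h
    have : (κ (Fin.succ (r i)) : ℝ) ≤ κ j := by exact_mod_cast h
    linarith [hg.2]

/-- On a piece, the comparison of two coordinates is decided by the pattern. -/
theorem lt_iff_of_mem_piece {r : Fin k → Fin M} {σ : Equiv.Perm (Fin k)} {z : Fin k → ℝ}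
    (hz : z ∈ piece κ r σ) (i i' : Fin k) :
    z i' < z i ↔ r i' < r i ∨ (r i' = r i ∧ σ.symm i < σ.symm i') := by
  have hg := mem_gap_of_mem_piece κ hz i
  have hg' := mem_gap_of_mem_piece κ hz i'
  have key : ∀ {i i' : Fin k}, r i' < r i → z i' < z i := by
    intro i i' hlt
    have h1 := (mem_gap_of_mem_piece κ hz i').2
    have h2 := (mem_gap_of_mem_piece κ hz i).1
    have hle : κ (Fin.succ (r i')) ≤ κ (Fin.castSucc (r i)) :=
      κ.monotone (by rw [Fin.le_def]; simp only [Fin.val_succ, Fin.val_castSucc]; omega)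
    have hle' : (κ (Fin.succ (r i')) : ℝ) ≤ κ (Fin.castSucc (r i)) := by exact_mod_cast hle
    simp only [glo, gd, Rat.cast_sub] at h1 h2
    linarith
  rcases lt_trichotomy (r i') (r i) with h | h | h
  · exact ⟨fun _ => Or.inl h, fun _ => key h⟩
  · have hd : (0 : ℝ) < gd κ r i := by exact_mod_cast gd_pos κ r i
    have hanti : StrictAnti (nmap κ r σ z) := hz.2.2
    have hcmp := hanti.lt_iff_gt (a := σ.symm i') (b := σ.symm i)
    have hglo : glo κ r i' = glo κ r i := by simp only [glo, h]
    have hgd : gd κ r i' = gd κ r i := by simp only [gd, h]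
    simp only [nmap, Equiv.apply_symm_apply, hglo, hgd] at hcmp
    rw [div_lt_div_iff_of_pos_right hd, sub_lt_sub_iff_right] at hcmp
    rw [hcmp]
    simp [h]
  · constructor
    · intro hlt; exact absurd (key h) (not_lt.2 hlt.le)
    · rintro (h' | ⟨h', _⟩)
      · exact absurd (h.trans h') (lt_irrefl _)
      · exact absurd (h' ▸ h) (lt_irrefl _)

/-- **Membership in an order cell is constant on every piece** (the cell is DECIDED by the pattern),
provided the constant bounds of the cell are among the `κ j`. -/
theorem mem_cell_of_mem_piece (lo hi : Fin k → Fin k ⊕ ℚ)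
    (hlo : ∀ i c, lo i = Sum.inr c → c ∈ Set.range κ) (hhi : ∀ i c, hi i = Sum.inr c → c ∈ Set.range κ)
    {r : Fin k → Fin M} {σ : Equiv.Perm (Fin k)} {z z' : Fin k → ℝ}
    (hz : z ∈ piece κ r σ) (hz' : z' ∈ piece κ r σ)
    (h : ∀ i, Sum.elim z (fun c : ℚ => (c : ℝ)) (lo i) < z i ∧
      z i < Sum.elim z (fun c : ℚ => (c : ℝ)) (hi i)) (i : Fin k) :
    Sum.elim z' (fun c : ℚ => (c : ℝ)) (lo i) < z' i ∧
      z' i < Sum.elim z' (fun c : ℚ => (c : ℝ)) (hi i) := by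
  obtain ⟨h1, h2⟩ := h i
  constructor
  · cases hl : lo i with
    | inl i' =>
      rw [hl] at h1
      exact (lt_iff_of_mem_piece κ hz' i i').2 ((lt_iff_of_mem_piece κ hz i i').1 h1)
    | inr c =>
      rw [hl] at h1
      exact (const_lt_iff_of_mem_piece κ hz' i (hlo i c hl)).2
        ((const_lt_iff_of_mem_piece κ hz i (hlo i c hl)).1 h1)
  · cases hh : hi i with
    | inl i' =>
      rw [hh] at h2
      exact (lt_iff_of_mem_piece κ hz' i' i).2 ((lt_iff_of_mem_piece κ hz i' i).1 h2)
    | inr c =>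
      rw [hh] at h2
      exact (lt_const_iff_of_mem_piece κ hz' i (hhi i c hh)).2
        ((lt_const_iff_of_mem_piece κ hz i (hhi i c hh)).1 h2)

/-- The exceptional set is Lebesgue-null (a finite union of proper affine hyperplanes). -/
theorem volume_excSet : volume (excSet k M κ) = 0 := by
  classical
  have hs : (Finsupp.single · 1 : Fin k → Fin k →₀ ℕ) = fun i => Finsupp.single i 1 := rfl
  have hne : ∀ i : Fin k, (Finsupp.single i 1 : Fin k →₀ ℕ) ≠ 0 := fun i =>
    Finsupp.single_ne_zero.2 one_ne_zero
  refine measure_union_null (measure_iUnion_null fun i => measure_iUnion_null fun j => ?_)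
    (measure_iUnion_null fun r => measure_iUnion_null fun i => measure_iUnion_null fun i' => ?_)
  · have h := MvPolynomial.volume_zeroSet_eq_zero k (X i - C (κ j : ℝ)) fun h => by
      have := congr_arg (coeff (Finsupp.single i 1)) h
      rw [coeff_sub, coeff_X_same, coeff_C_of_ne_zero (hne i), coeff_zero] at this
      norm_num at this
    refine measure_mono_null (fun z hz => ?_) h
    simpa [sub_eq_zero] using hz
  · by_cases hii : i = i'
    · have : {z : Fin k → ℝ | i ≠ i' ∧ (z i - glo κ r i) / gd κ r i = (z i' - glo κ r i') / gd κ r i'} =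
          ∅ := by
        ext z; simp [hii]
      rw [this, measure_empty]
    · have h := MvPolynomial.volume_zeroSet_eq_zero k
        (C ((gd κ r i : ℝ))⁻¹ * (X i - C (glo κ r i : ℝ)) -
          C ((gd κ r i' : ℝ))⁻¹ * (X i' - C (glo κ r i' : ℝ))) fun h => by
        have := congr_arg (coeff (Finsupp.single i 1)) h
        rw [coeff_sub, coeff_C_mul, coeff_C_mul, coeff_sub, coeff_sub, coeff_X_same, coeff_X,
          if_neg ((Finsupp.single_left_inj one_ne_zero).not.2 (Ne.symm hii)),
          coeff_C_of_ne_zero (hne i), coeff_C_of_ne_zero (hne i), coeff_zero] at this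
        norm_num at this
        exact (gd_pos κ r i).ne' this
      refine measure_mono_null (fun z hz => ?_) h
      have hz2 := hz.2
      simp only [mem_setOf_eq, map_sub, map_mul, eval_C, eval_X]
      rw [div_eq_inv_mul, div_eq_inv_mul] at hz2
      rw [hz2, sub_self]

/-- Off the exceptional set, every point of the cube `(κ 0, κ M)^k` lies in some piece (sort the
rescaled coordinates). -/
theorem exists_mem_piece {z : Fin k → ℝ} (hz0 : ∀ i, (κ 0 : ℝ) < z i)
    (hz1 : ∀ i, z i < κ (Fin.last M)) (hex : z ∉ excSet k M κ) :
    ∃ (r : Fin k → Fin M) (σ : Equiv.Perm (Fin k)), z ∈ piece κ r σ := by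
  classical
  simp only [excSet, mem_union, mem_iUnion, mem_setOf_eq, not_or, not_exists, not_and] at hex
  have hgap : ∀ i, ∃ j : Fin M, (κ (Fin.castSucc j) : ℝ) < z i ∧ z i < κ (Fin.succ j) := fun i =>
    unletter_exists_gap M κ (z i) (hz0 i) (hz1 i) fun j => hex.1 i j
  choose r hr using hgap
  set x : Fin k → ℝ := fun i => (z i - glo κ r i) / gd κ r i with hx
  have hxinj : Function.Injective x := fun i i' h => by
    by_contra hii
    exact hex.2 r i i' hii h
  set σ : Equiv.Perm (Fin k) := Fin.revPerm.trans (Tuple.sort x) with hσ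
  have hmono : StrictMono (x ∘ Tuple.sort x) :=
    (Tuple.monotone_sort x).strictMono_of_injective (hxinj.comp (Tuple.sort x).injective)
  refine ⟨r, σ, fun j => ?_, fun j => ?_, fun a b hab => ?_⟩
  · have hd : (0 : ℝ) < gd κ r (σ j) := by exact_mod_cast gd_pos κ r (σ j)
    simp only [nmap]
    exact div_pos (by have := (hr (σ j)).1; simp only [glo]; linarith) hd
  · have hd : (0 : ℝ) < gd κ r (σ j) := by exact_mod_cast gd_pos κ r (σ j)
    simp only [nmap]
    rw [div_lt_one hd]
    have := (hr (σ j)).2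
    simp only [glo, gd, Rat.cast_sub]
    linarith
  · have : nmap κ r σ z = fun j => (x ∘ Tuple.sort x) (Fin.rev j) := by
      ext j; simp [nmap, hx, hσ]
    rw [this]
    exact hmono (Fin.rev_lt_rev.2 hab)

/-- **Dissection of a bounded lettered order cell** (rule 1a over all patterns, then normalisation
of every piece): a representation on a bounded order cell `{lo i < zᵢ < hi i}` (bounds: other
coordinates or rational constants) with integrand `q ∏ lett (a i) (zᵢ)` lies in `RS`. -/
theorem orderCell_mem_RS (s : KZ.IntegralRep k) (q : ℚ) (a : Fin k → Option ℚ)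
    (lo hi : Fin k → Fin k ⊕ ℚ) (hbd : Bornology.IsBounded s.domain)
    (hdom : s.domain = {z | ∀ i, Sum.elim z (fun c : ℚ => (c : ℝ)) (lo i) < z i ∧
      z i < Sum.elim z (fun c : ℚ => (c : ℝ)) (hi i)})
    (hint : EqOn s.integrand (fun z => (q : ℝ) * ∏ i, lett (a i) (z i)) s.domain) :
    KZ.of s ∈ RS := by
  classical
  -- a rational bound for the cell
  obtain ⟨C0, hC0⟩ := isBounded_iff_forall_norm_le.1 hbd
  obtain ⟨B, hB⟩ := exists_rat_gt (max C0 0)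
  have hzB : ∀ z ∈ s.domain, ∀ i, -(B : ℝ) < z i ∧ z i < B := fun z hz i => by
    have h1 : |z i| ≤ C0 := (norm_le_pi_norm z i).trans (hC0 z hz)
    have h2 : (C0 : ℝ) < B := (le_max_left _ _).trans_lt hB
    constructor
    · linarith [neg_abs_le (z i)]
    · linarith [le_abs_self (z i)]
  -- the constants, sorted
  set Kset : Finset ℚ := (Finset.univ.biUnion fun i : Fin k =>
    Sum.elim (fun _ => (∅ : Finset ℚ)) (fun c => {c}) (lo i) ∪
      Sum.elim (fun _ => (∅ : Finset ℚ)) (fun c => {c}) (hi i)) ∪ {B, -B} with hK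
  have hBK : B ∈ Kset := by simp [hK]
  have hnBK : -B ∈ Kset := by simp [hK]
  obtain ⟨M, hM⟩ : ∃ M, Kset.card = M + 1 :=
    ⟨Kset.card - 1, by have := Finset.card_pos.2 ⟨B, hBK⟩; omega⟩
  set κ : Fin (M + 1) ↪o ℚ := Kset.orderEmbOfFin hM with hκ
  have hKr : ∀ c ∈ Kset, c ∈ Set.range κ := fun c hc => by
    rw [hκ, Finset.range_orderEmbOfFin]; exact hc
  have hloK : ∀ i c, lo i = Sum.inr c → c ∈ Set.range κ := fun i c h => hKr c (by
    rw [hK, Finset.mem_union, Finset.mem_biUnion]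
    exact Or.inl ⟨i, Finset.mem_univ i, by simp [h]⟩)
  have hhiK : ∀ i c, hi i = Sum.inr c → c ∈ Set.range κ := fun i c h => hKr c (by
    rw [hK, Finset.mem_union, Finset.mem_biUnion]
    exact Or.inl ⟨i, Finset.mem_univ i, by simp [h]⟩)
  have hκ0 : (κ 0 : ℝ) ≤ -B := by
    obtain ⟨j, hj⟩ := hKr _ hnBK
    have : κ 0 ≤ κ j := κ.monotone (Fin.zero_le j)
    rw [hj] at this
    exact_mod_cast this
  have hκM : (B : ℝ) ≤ κ (Fin.last M) := by
    obtain ⟨j, hj⟩ := hKr _ hBK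
    have : κ j ≤ κ (Fin.last M) := κ.monotone (Fin.le_last j)
    rw [hj] at this
    exact_mod_cast this
  -- rule 1a over all patterns
  let R : (Fin k → Fin M) × Equiv.Perm (Fin k) → KZ.IntegralRep k := fun p =>
    s.restrict (s.domain ∩ piece κ p.1 p.2)
      (s.isSemialgebraic_domain.inter (isSemialgebraic_piece κ p.1 p.2)) inter_subset_left
  have hdis : KZ.of s - ∑ p ∈ Finset.univ, KZ.of (R p) ∈ KZ.relations := by
    refine KZ.of_sub_sum_of_mem_relations Finset.univ s R (fun p _ => ?_) (fun p _ z _ => rfl)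
      (measure_mono_null (fun z hz => ?_) (volume_excSet (k := k) κ)) fun p _ p' _ hne => ?_
    · change volume ((s.domain ∩ piece κ p.1 p.2) \ s.domain) = 0
      rw [Set.sdiff_eq_empty.2 inter_subset_left, measure_empty]
    · by_contra hex
      obtain ⟨r, σ, hmem⟩ := exists_mem_piece κ (fun i => hκ0.trans_lt (hzB z hz.1 i).1)
        (fun i => (hzB z hz.1 i).2.trans_le hκM) hex
      exact hz.2 (mem_iUnion₂.2 ⟨(r, σ), Finset.mem_univ _, hz.1, hmem⟩)
    · change volume ((s.domain ∩ piece κ p.1 p.2) ∩ (s.domain ∩ piece κ p'.1 p'.2)) = 0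
      have h0 : piece κ p.1 p.2 ∩ piece κ p'.1 p'.2 = ∅ := piece_disjoint κ (by simpa using hne)
      rw [inter_inter_inter_comm, h0, inter_empty, measure_empty]
  -- every piece lies in `RS`
  have hR : ∀ p, KZ.of (R p) ∈ RS := by
    intro p
    by_cases hex : (s.domain ∩ piece κ p.1 p.2).Nonempty
    · obtain ⟨z₀, hz₀D, hz₀S⟩ := hex
      have hsubS : piece κ p.1 p.2 ⊆ s.domain := fun z hz => by
        rw [hdom] at hz₀D ⊢
        exact fun i => mem_cell_of_mem_piece κ lo hi hloK hhiK hz₀S hz hz₀D i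
      have h1 : KZ.of (R p) - KZ.of (s.restrict (piece κ p.1 p.2) (isSemialgebraic_piece κ p.1 p.2)
          hsubS) ∈ KZ.relations :=
        KZ.of_sub_of_mem_relations_of_eqOn (by simp [R, inter_eq_right.2 hsubS]) fun _ _ => rfl
      exact mem_RS_of_sub_mem h1 (restrict_piece_mem_RS κ p.1 p.2 s q a hsubS hint)
    · refine mem_RS_of_mem_relations (KZ.of_mem_relations_of_volume_eq_zero _ ?_)
      change volume (s.domain ∩ piece κ p.1 p.2) = 0
      rw [not_nonempty_iff_eq_empty.1 hex, measure_empty]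
  have : KZ.of s = (KZ.of s - ∑ p ∈ Finset.univ, KZ.of (R p)) + ∑ p ∈ Finset.univ, KZ.of (R p) := by
    abel
  rw [this]
  exact add_mem (mem_RS_of_mem_relations hdis) (AddSubgroup.sum_mem _ fun p _ => hR p)

end Patterns

end Unletter

end Summit.KontsevichZagierPeriods.ArrangementNormalForm.JanusBands
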